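import Mathlib

/-!
# Route OverlapGapAlgebra, crux `SolvableImpliesStableSection` (stmt-PneNP-2463), line `Sketch`:
# Stub 4 `stub_lazyWalks` — harmless walks from a bad start never move

We consider the lazy coordinate-resampling walk on `J → S` (Bresler–Huang, arXiv:2106.02129, §6.2):
`pos v U t` is the position after `t` steps of the walk started at `v` with resampling string
`U : Fin T → S`; it is characterised only by `hpos0` (`pos v U 0 = v`) and `hposS` (step `t < T`
overwrites coordinate `σ t` with the fresh symbol `U t`).  Step `t` is *lazy* when
`U t = pos v U t (σ t)` (the walk does not move, `Function.update_eq_self`) and *harmless* when it is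
lazy or its edge is not bad, where `Bad v w ↔ ¬ InG v ∨ ¬ InG w ∨ D v w`.

**Claim (`stub_lazyWalks`).** The number of pairs `(v, U)` with a bad start (`¬ InG v`) all of whose
`T` steps are harmless is at most `Fintype.card (J → S)`.

**Proof.** If `¬ InG v`, every edge out of `v` is bad (first disjunct of `Bad`), so a harmless step
taken while the walk sits at `v` is lazy: `U t = v (σ t)`, and the walk is still at `v` afterwards
(`Function.update_eq_self`).  By induction on `t`, the walk never leaves `v` (`pos v U t = v` for all
`t ≤ T`), hence the whole resampling string is forced, `U t = v (σ t)` for every `t : Fin T`.  So the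
first projection `Prod.fst` is injective on the set of such pairs, and `Finset.card_le_card_of_injOn`
bounds its cardinality by `#(univ : Finset (J → S)) = Fintype.card (J → S)`.
-/

set_option linter.dupNamespace false

namespace Summit.PneNP.PneNP.Cruxes.SolvableImpliesStableSection.Sketch

open Finset
open scoped Classical

/-- One step of a harmless walk sitting at a bad point: if `¬ InG v`, the walk is at `v` at time
`t < T` (`pos v U t = v`) and step `t` is lazy or not bad, then the step is lazy, `U t = v (σ t)`,
and the walk is still at `v` at time `t + 1`.  (A non-lazy step would be an edge out of `v`, which is
bad by the first disjunct of `Bad`; a lazy step does not move by `Function.update_eq_self`.) -/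
private theorem lw_step {S J : Type*} [DecidableEq J] {T : ℕ} (σ : Fin T → J)
    (InG : (J → S) → Prop) (Bad : (J → S) → (J → S) → Prop)
    (hBadL : ∀ v w, ¬ InG v → Bad v w)
    (pos : (J → S) → (Fin T → S) → ℕ → (J → S)) (v : J → S) (U : Fin T → S)
    (hposS : ∀ t : Fin T, pos v U ((t : ℕ) + 1) = Function.update (pos v U t) (σ t) (U t))
    (hv : ¬ InG v) (t : Fin T) (ht : pos v U t = v)
    (hno : U t = pos v U t (σ t) ∨ ¬ Bad (pos v U t) (pos v U ((t : ℕ) + 1))) :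
    U t = v (σ t) ∧ pos v U ((t : ℕ) + 1) = v := by
  rw [ht] at hno
  have hU : U t = v (σ t) := hno.resolve_right fun h => h (hBadL v _ hv)
  refine ⟨hU, ?_⟩
  rw [hposS t, ht, hU, Function.update_eq_self]

/-- A harmless walk from a bad start never moves: if `¬ InG v` and every step `t < T` is lazy or not
bad, then `pos v U t = v` for every `t ≤ T`.  Induction on `t`, the step being `lw_step`. -/
private theorem lw_stays {S J : Type*} [DecidableEq J] {T : ℕ} (σ : Fin T → J)
    (InG : (J → S) → Prop) (Bad : (J → S) → (J → S) → Prop)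
    (hBadL : ∀ v w, ¬ InG v → Bad v w)
    (pos : (J → S) → (Fin T → S) → ℕ → (J → S)) (v : J → S) (U : Fin T → S)
    (hpos0 : pos v U 0 = v)
    (hposS : ∀ t : Fin T, pos v U ((t : ℕ) + 1) = Function.update (pos v U t) (σ t) (U t))
    (hv : ¬ InG v)
    (hno : ∀ t : Fin T, U t = pos v U t (σ t) ∨ ¬ Bad (pos v U t) (pos v U ((t : ℕ) + 1))) :
    ∀ t : ℕ, t ≤ T → pos v U t = v := by
  intro t
  induction t with
  | zero => exact fun _ => hpos0
  | succ t ih =>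
    intro ht
    have htT : t < T := ht
    exact (lw_step σ InG Bad hBadL pos v U hposS hv ⟨t, htT⟩ (ih htT.le) (hno ⟨t, htT⟩)).2

/-- The resampling string of a harmless walk from a bad start is forced: if `¬ InG v` and every step
`t < T` is lazy or not bad, then `U t = v (σ t)` for every `t : Fin T` (the walk sits at `v` at time
`t` by `lw_stays`, and then step `t` is lazy by `lw_step`). -/
private theorem lw_forced {S J : Type*} [DecidableEq J] {T : ℕ} (σ : Fin T → J)
    (InG : (J → S) → Prop) (Bad : (J → S) → (J → S) → Prop)
    (hBadL : ∀ v w, ¬ InG v → Bad v w)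
    (pos : (J → S) → (Fin T → S) → ℕ → (J → S)) (v : J → S) (U : Fin T → S)
    (hpos0 : pos v U 0 = v)
    (hposS : ∀ t : Fin T, pos v U ((t : ℕ) + 1) = Function.update (pos v U t) (σ t) (U t))
    (hv : ¬ InG v)
    (hno : ∀ t : Fin T, U t = pos v U t (σ t) ∨ ¬ Bad (pos v U t) (pos v U ((t : ℕ) + 1)))
    (t : Fin T) : U t = v (σ t) :=
  (lw_step σ InG Bad hBadL pos v U hposS hv t
    (lw_stays σ InG Bad hBadL pos v U hpos0 hposS hv hno t t.isLt.le) (hno t)).1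

/-- **Stub 4 — harmless walks from a bad start never move.**
For the lazy resampling walk `pos v U` on `J → S` (start `v` by `hpos0`; step `t < T` overwrites
coordinate `σ t` with `U t` by `hposS`) and `Bad v w ↔ ¬ InG v ∨ ¬ InG w ∨ D v w`: the pairs
`(v, U)` with a bad start `¬ InG v` all of whose steps are lazy (`U t = pos v U t (σ t)`) or not
`Bad` number at most `Fintype.card (J → S)`.  Indeed every edge out of a bad point is bad, so such a
walk is lazy at every step and never leaves `v`, which forces `U t = v (σ t)` (`lw_forced`); thus
`Prod.fst` is injective on this set and `Finset.card_le_card_of_injOn` applies.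
Source of the walk: Bresler–Huang, arXiv:2106.02129, §6.2. -/
theorem stub_lazyWalks {S J : Type*} [Fintype S] [Fintype J] [DecidableEq S] [DecidableEq J]
    (T : ℕ) (σ : Fin T → J) (InG : (J → S) → Prop) (D Bad : (J → S) → (J → S) → Prop)
    (hBad : ∀ v w, Bad v w ↔ (¬ InG v ∨ ¬ InG w ∨ D v w))
    (pos : (J → S) → (Fin T → S) → ℕ → (J → S))
    (hpos0 : ∀ v U, pos v U 0 = v)
    (hposS : ∀ v U (t : Fin T), pos v U ((t : ℕ) + 1) = Function.update (pos v U t) (σ t) (U t)) :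
    ((univ : Finset ((J → S) × (Fin T → S))).filter fun vU =>
        ¬ InG vU.1 ∧ ∀ t : Fin T, vU.2 t = pos vU.1 vU.2 t (σ t) ∨
          ¬ Bad (pos vU.1 vU.2 t) (pos vU.1 vU.2 ((t : ℕ) + 1))).card
      ≤ Fintype.card (J → S) := by
  -- every edge out of a bad point is bad
  have hBadL : ∀ v w, ¬ InG v → Bad v w := fun v w h => (hBad v w).2 (Or.inl h)
  rw [← Finset.card_univ]
  refine Finset.card_le_card_of_injOn Prod.fst (fun _ _ => Finset.mem_coe.2 (Finset.mem_univ _)) ?_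
  rintro ⟨v, U⟩ hvU ⟨v', U'⟩ hvU' hfst
  obtain rfl : v = v' := hfst
  obtain ⟨hv, hno⟩ := (Finset.mem_filter.1 (Finset.mem_coe.1 hvU)).2
  obtain ⟨-, hno'⟩ := (Finset.mem_filter.1 (Finset.mem_coe.1 hvU')).2
  refine Prod.ext rfl (funext fun t => ?_)
  exact (lw_forced σ InG Bad hBadL pos v U (hpos0 v U) (hposS v U) hv hno t).trans
    (lw_forced σ InG Bad hBadL pos v U' (hpos0 v U') (hposS v U') hv hno' t).symm

end Summit.PneNP.PneNP.Cruxes.SolvableImpliesStableSection.Sketch
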